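import Mathlib
import Summits.ValiantsHypothesis.ValiantsHypothesis.Theorems.NewtonUnitEquationsTwoProductsDepthOne
import Summits.ValiantsHypothesis.ValiantsHypothesis.Theorems.NewtonUnitEquationsTwoProductsPeelShallow

/-! # Brick `stub_eulerTransfer` — crux `TwoProducts` (stmt-ValiantsHypothesis-5906), line `corner-log-linearization`

EULER TRANSFER (stub 8a).  Let `P, Q ∈ ℂ[x,y]` have the same nonzero constant term and let `θ = x∂ₓ + y∂_y = Σ_i X_i ∂_i` be
the Euler operator, so `coeff_a (θ f) = (a₀ + a₁) · coeff_a f` (`coeff_euler`).  Then for every integer weight `w` with both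
entries positive, the strict `w`-minimisers of `supp (P − Q)` and of `supp (θP·Q − P·θQ)` coincide.

Proof.  Put `R = P − Q` (so `coeff_0 R = 0`) and note `θP·Q − P·θQ = θR·Q − R·θQ =: N` (`θ` is additive).  The key
computation (`coeff_transfer`): if `coeff_b R = 0` for every `b` strictly `w`-lighter than `a`, then
`coeff_a N = (a₀ + a₁) · Q(0) · coeff_a R` — in the antidiagonal expansion of `coeff_a (θR·Q)` and `coeff_a (R·θQ)` a
summand indexed by `(b, d)` with `d ≠ 0` has `b` strictly lighter than `a` (positive weights), hence vanishes, and the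
summand `d = 0` is `(a₀+a₁)·coeff_a R · Q(0)` resp. `coeff_a R · 0`.  Consequently (`core`) a strict minimiser of either
support is a strict minimiser of the other (both supports avoid `0`, where the factor `a₀ + a₁` would vanish).  The
lemmas `coeff_transfer` and `core` are stated for an abstract operator `T` with `coeff_a (T f) = (a₀ + a₁) · coeff_a f` and an
abstract additive weight `W` positive off `0`; the brick instantiates them with `θ` and `a ↦ w₀ a₀ + w₁ a₁` (additivity and
positivity of the latter: `PeelShallow.wt_add`, `DepthOne.wt_pos` of this directory). [folklore] -/

set_option linter.dupNamespace false -- single-conjunct summit: `ValiantsHypothesis.ValiantsHypothesis`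

namespace Summit.ValiantsHypothesis.ValiantsHypothesis.Theorems.TwoProducts.EulerTransfer

open scoped BigOperators Classical

open MvPolynomial
open Summit.ValiantsHypothesis.ValiantsHypothesis.Theorems.TwoProducts.DepthOne (wt_pos)
open Summit.ValiantsHypothesis.ValiantsHypothesis.Theorems.TwoProducts.PeelShallow (wt_add)

/-! ## The Euler operator on coefficients -/

/-- `coeff_e (X_i ∂_i f) = e_i · coeff_e f`. [folklore] -/
theorem coeff_X_mul_pderiv (i : Fin 2) (f : MvPolynomial (Fin 2) ℂ) (e : Fin 2 →₀ ℕ) :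
    coeff e (X i * pderiv i f) = (e i : ℂ) * coeff e f := by
  induction f using MvPolynomial.induction_on' with
  | monomial m r =>
    rw [X_mul_pderiv_monomial, ← Nat.cast_smul_eq_nsmul ℂ, coeff_smul, coeff_monomial, smul_eq_mul]
    split_ifs with h
    · rw [h]
    · rw [mul_zero, mul_zero]
  | add p q hp hq => rw [map_add, mul_add, coeff_add, coeff_add, hp, hq, mul_add]

/-- Euler operator on coefficients: `coeff_e (Σ_i X_i ∂_i f) = (e₀ + e₁) · coeff_e f`. [folklore] -/
theorem coeff_euler (f : MvPolynomial (Fin 2) ℂ) (e : Fin 2 →₀ ℕ) :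
    coeff e (∑ i : Fin 2, X i * pderiv i f) = ((e 0 : ℂ) + (e 1 : ℂ)) * coeff e f := by
  rw [Fin.sum_univ_two, coeff_add, coeff_X_mul_pderiv, coeff_X_mul_pderiv, add_mul]

/-- The Euler operator is additive. [folklore] -/
theorem euler_add (f g : MvPolynomial (Fin 2) ℂ) :
    (∑ i : Fin 2, X i * pderiv i (f + g)) =
      (∑ i : Fin 2, X i * pderiv i f) + ∑ i : Fin 2, X i * pderiv i g := by
  simp only [map_add, mul_add, Finset.sum_add_distrib]

/-- An exponent vector with both entries zero is zero. [folklore] -/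
theorem finsupp_two_eq_zero {a : Fin 2 →₀ ℕ} (h0 : a 0 = 0) (h1 : a 1 = 0) : a = 0 :=
  Finsupp.ext fun i => by
    have h : ∀ j : Fin 2, a j = 0 := Fin.forall_fin_two.mpr ⟨h0, h1⟩
    simpa using h i

/-- For `a ≠ 0` the Euler factor `a₀ + a₁` is a nonzero complex number. [folklore] -/
theorem euler_factor_ne_zero (a : Fin 2 →₀ ℕ) (ha : a ≠ 0) : (a 0 : ℂ) + (a 1 : ℂ) ≠ 0 := by
  have h : a 0 ≠ 0 ∨ a 1 ≠ 0 := by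
    by_contra h
    push Not at h
    exact ha (finsupp_two_eq_zero h.1 h.2)
  have h' : a 0 + a 1 ≠ 0 := by rcases h with h | h <;> omega
  exact_mod_cast h'

/-! ## The transfer, for an abstract Euler-type operator `T` and an abstract additive positive weight `W` -/

/-- KEY COMPUTATION.  Let `T` act on coefficients by `coeff_e (T f) = (e₀ + e₁) · coeff_e f` and let `W` be an additive
weight, positive off `0`.  If `coeff_b R = 0` for every `b` strictly `W`-lighter than `a`, then
`coeff_a (T R · Q − R · T Q) = (a₀ + a₁) · Q(0) · coeff_a R`. [folklore] -/
theorem coeff_transfer (T : MvPolynomial (Fin 2) ℂ → MvPolynomial (Fin 2) ℂ)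
    (hT : ∀ (f : MvPolynomial (Fin 2) ℂ) (e : Fin 2 →₀ ℕ), coeff e (T f) = ((e 0 : ℂ) + (e 1 : ℂ)) * coeff e f)
    (W : (Fin 2 →₀ ℕ) → ℤ) (hadd : ∀ a b, W (a + b) = W a + W b) (hpos : ∀ d, d ≠ 0 → 0 < W d)
    (R Q : MvPolynomial (Fin 2) ℂ) (a : Fin 2 →₀ ℕ) (ha : ∀ b, W b < W a → coeff b R = 0) :
    coeff a (T R * Q - R * T Q) = ((a 0 : ℂ) + (a 1 : ℂ)) * coeff 0 Q * coeff a R := by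
  -- a summand `(b, d)` of the antidiagonal of `a` with `d ≠ 0` has `b` strictly lighter than `a`
  have hlight : ∀ b d : Fin 2 →₀ ℕ, b + d = a → d ≠ 0 → W b < W a := by
    intro b d hbd hd
    rw [← hbd, hadd]
    linarith [hpos d hd]
  have h1 : coeff a (T R * Q) = ((a 0 : ℂ) + (a 1 : ℂ)) * coeff a R * coeff 0 Q := by
    rw [coeff_mul, Finset.sum_eq_single (a, 0)]
    · show coeff a (T R) * coeff 0 Q = _
      rw [hT]
    · rintro ⟨b, d⟩ hbd hne
      have hbd' : b + d = a := by simpa [Finset.mem_antidiagonal] using hbd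
      have hd : d ≠ 0 := by
        rintro rfl
        apply hne
        rw [← hbd', add_zero]
      show coeff b (T R) * coeff d Q = 0
      rw [hT, ha b (hlight b d hbd' hd), mul_zero, zero_mul]
    · intro h
      exact (h (by simp)).elim
  have h2 : coeff a (R * T Q) = 0 := by
    rw [coeff_mul]
    refine Finset.sum_eq_zero ?_
    rintro ⟨b, d⟩ hbd
    have hbd' : b + d = a := by simpa [Finset.mem_antidiagonal] using hbd
    show coeff b R * coeff d (T Q) = 0
    by_cases hd : d = 0
    · rw [hd, hT]
      simp
    · rw [ha b (hlight b d hbd' hd), zero_mul]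
  rw [coeff_sub, h1, h2, sub_zero]
  ring

/-- CORE (`T`, `W` as in `coeff_transfer`): if `R(0) = 0` and `Q(0) ≠ 0`, the strict `W`-minimisers of `supp R` and of
`supp (T R · Q − R · T Q)` coincide. [folklore] -/
theorem core (T : MvPolynomial (Fin 2) ℂ → MvPolynomial (Fin 2) ℂ)
    (hT : ∀ (f : MvPolynomial (Fin 2) ℂ) (e : Fin 2 →₀ ℕ), coeff e (T f) = ((e 0 : ℂ) + (e 1 : ℂ)) * coeff e f)
    (W : (Fin 2 →₀ ℕ) → ℤ) (hadd : ∀ a b, W (a + b) = W a + W b) (hpos : ∀ d, d ≠ 0 → 0 < W d)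
    (R Q : MvPolynomial (Fin 2) ℂ) (hR : coeff 0 R = 0) (hQ : coeff 0 Q ≠ 0) (e : Fin 2 →₀ ℕ) :
    (e ∈ R.support ∧ ∀ e' ∈ R.support, e' ≠ e → W e < W e') ↔
      (e ∈ (T R * Q - R * T Q).support ∧ ∀ e' ∈ (T R * Q - R * T Q).support, e' ≠ e → W e < W e') := by
  -- the weight vanishes at `0` and is nonnegative
  have hW0 : W 0 = 0 := by
    have h := hadd 0 0
    rw [add_zero] at h
    linarith
  have hWnn : ∀ b, 0 ≤ W b := by
    intro b
    rcases eq_or_ne b 0 with rfl | hb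
    · exact le_of_eq hW0.symm
    · exact (hpos b hb).le
  -- support points of `R` are nonzero vectors
  have hR0 : ∀ a ∈ R.support, a ≠ 0 := by
    rintro a ha rfl
    exact (mem_support_iff.mp ha) hR
  -- support points of `N = T R · Q − R · T Q` are nonzero vectors
  have hN0 : ∀ a ∈ (T R * Q - R * T Q).support, a ≠ 0 := by
    rintro a ha rfl
    have H0 : ∀ b, W b < W 0 → coeff b R = 0 := by
      intro b hb
      rw [hW0] at hb
      exact absurd hb (not_lt.mpr (hWnn b))
    rw [mem_support_iff, coeff_transfer T hT W hadd hpos R Q 0 H0] at ha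
    apply ha
    simp
  -- under the lightness hypothesis at `a ≠ 0`, membership in the two supports is the same
  have key : ∀ a : Fin 2 →₀ ℕ, a ≠ 0 → (∀ b, W b < W a → coeff b R = 0) →
      (a ∈ (T R * Q - R * T Q).support ↔ a ∈ R.support) := by
    intro a ha0 H
    rw [mem_support_iff, mem_support_iff, coeff_transfer T hT W hadd hpos R Q a H]
    have h1 := euler_factor_ne_zero a ha0
    constructor
    · intro h hR'
      apply h
      rw [hR', mul_zero]
    · intro h
      exact mul_ne_zero (mul_ne_zero h1 hQ) h
  constructor
  · rintro ⟨he, hmin⟩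
    have He : ∀ b, W b < W e → coeff b R = 0 := by
      intro b hb
      by_contra hbR
      have hne : b ≠ e := by
        rintro rfl
        exact lt_irrefl _ hb
      exact lt_asymm hb (hmin b (mem_support_iff.mpr hbR) hne)
    refine ⟨(key e (hR0 e he) He).mpr he, fun e' he' hne => ?_⟩
    by_contra hle
    push Not at hle
    have He' : ∀ b, W b < W e' → coeff b R = 0 := fun b hb => He b (lt_of_lt_of_le hb hle)
    exact absurd (hmin e' ((key e' (hN0 e' he') He').mp he') hne) (not_lt.mpr hle)
  · rintro ⟨he, hmin⟩
    have He : ∀ b, W b < W e → coeff b R = 0 := by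
      by_contra hcon
      push Not at hcon
      obtain ⟨b, hb, hbR⟩ := hcon
      obtain ⟨a, haR, hamin⟩ := Finset.exists_min_image R.support W ⟨b, mem_support_iff.mpr hbR⟩
      have Ha : ∀ b', W b' < W a → coeff b' R = 0 := by
        intro b' hb'
        by_contra hb'R
        exact absurd (hamin b' (mem_support_iff.mpr hb'R)) (not_le.mpr hb')
      have hae : W a < W e := lt_of_le_of_lt (hamin b (mem_support_iff.mpr hbR)) hb
      have hne : a ≠ e := by
        rintro rfl
        exact lt_irrefl _ hae
      exact absurd (hmin a ((key a (hR0 a haR) Ha).mpr haR) hne) (not_lt.mpr hae.le)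
    have heR : e ∈ R.support := (key e (hN0 e he) He).mp he
    refine ⟨heR, fun e' he' hne => ?_⟩
    by_contra hle
    push Not at hle
    have He' : ∀ b, W b < W e' → coeff b R = 0 := fun b hb => He b (lt_of_lt_of_le hb hle)
    exact absurd (hmin e' ((key e' (hR0 e' he') He').mpr he') hne) (not_lt.mpr hle)

/-! ## The brick -/

/-- **BRICK `stub_eulerTransfer`** (registered signature): for `P, Q ∈ ℂ[x,y]` with the same nonzero constant term and
every integer weight with positive entries, the strict minimisers of `supp (P − Q)` and of `supp (θP·Q − P·θQ)`
(`θ = Σ_i X_i ∂_i`) coincide. [folklore] -/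
theorem stub_eulerTransfer : ∀ (P Q : MvPolynomial (Fin 2) ℂ),
    MvPolynomial.coeff 0 P = MvPolynomial.coeff 0 Q → MvPolynomial.coeff 0 Q ≠ 0 →
    ∀ (w : Fin 2 → ℤ), 0 < w 0 → 0 < w 1 → ∀ (e : Fin 2 →₀ ℕ),
    ((e ∈ (P - Q).support ∧ ∀ e' ∈ (P - Q).support, e' ≠ e →
        w 0 * (e 0 : ℤ) + w 1 * (e 1 : ℤ) < w 0 * (e' 0 : ℤ) + w 1 * (e' 1 : ℤ)) ↔
      (e ∈ ((∑ i : Fin 2, MvPolynomial.X i * MvPolynomial.pderiv i P) * Q -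
              P * (∑ i : Fin 2, MvPolynomial.X i * MvPolynomial.pderiv i Q)).support ∧
        ∀ e' ∈ ((∑ i : Fin 2, MvPolynomial.X i * MvPolynomial.pderiv i P) * Q -
              P * (∑ i : Fin 2, MvPolynomial.X i * MvPolynomial.pderiv i Q)).support, e' ≠ e →
          w 0 * (e 0 : ℤ) + w 1 * (e 1 : ℤ) < w 0 * (e' 0 : ℤ) + w 1 * (e' 1 : ℤ))) := by
  intro P Q hPQ hQ w hw0 hw1 e
  have hR : coeff 0 (P - Q) = 0 := by rw [coeff_sub, hPQ, sub_self]
  -- `θP = θ(P − Q) + θQ`, so `θP·Q − P·θQ = θ(P − Q)·Q − (P − Q)·θQ`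
  have hθ : (∑ i : Fin 2, X i * pderiv i P) =
      (∑ i : Fin 2, X i * pderiv i (P - Q)) + ∑ i : Fin 2, X i * pderiv i Q := by
    rw [← euler_add, sub_add_cancel]
  have hN : (∑ i : Fin 2, X i * pderiv i P) * Q - P * (∑ i : Fin 2, X i * pderiv i Q) =
      (∑ i : Fin 2, X i * pderiv i (P - Q)) * Q - (P - Q) * (∑ i : Fin 2, X i * pderiv i Q) := by
    rw [hθ]
    ring
  rw [hN]
  exact core (fun f => ∑ i : Fin 2, X i * pderiv i f) coeff_euler
    (fun a => w 0 * (a 0 : ℤ) + w 1 * (a 1 : ℤ)) (wt_add w) (wt_pos w hw0 hw1) (P - Q) Q hR hQ e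

end Summit.ValiantsHypothesis.ValiantsHypothesis.Theorems.TwoProducts.EulerTransfer
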